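import Mathlib.FieldTheory.PurelyInseparable.Basic
import Mathlib.FieldTheory.RatFunc.Basic
import Mathlib.FieldTheory.Perfect
import Literature.AlgebraicGeometry.Resolution.ResolutionOfSingularities
import HarnessLib

/-!
# [OURS · L1 W8.2] The DIMENSION-GRADED climb kernel of slot W8.2 (rung B, prime-field / family
# transfer) — campaign statement, Theses-free module

Cell `res-hironaka` (run/shared/lean/pub/res-hironaka/), LADDER-RESOLUTION rung L (RESCUE), slot W8.2 of
plan/RESCUE-SEED.md («PRIME-FIELD / UNIVERSALITY TRANSFER instead of descent»), host route `UniversalCells`,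
host item `PrimeFieldToPerfect` (stmt-ResolutionOfSingularities-15233); second door `UniformComplexity`
`PrimeModelTransfer` (stmt-ResolutionOfSingularities-8933). Statement-only file (typer res-L1-type-o6,
statement-only lane): one OURS `Prop` with two dimension bounds and two pure-logic anchors; NOTHING is
proved about resolution of singularities here and nothing is asserted.

WHY THIS FILE. Kill test K8.2 came back ALIVE (res-L1-k82, L/res-L1-k82/KILL-TEST-K8.2.md): both doors of the
slot reduce, kernel-checked, to ONE open statement per prime `p` — the climb kernel
`Summit.ResolutionOfSingularities.ResolutionOfSingularities.Theorems.CampaignW82.ClimbRatFuncPerf p`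
(Theorems/UniversalCellsCampaignW82PrimeFieldTransfer.lean, p460619; verbatim the registered stub
`stub_climbRatFuncPerf` of stmt-15233 RESHAPE 4 and of line `shared-climb-kernel` of stmt-8933; reductions
`Theorems.PrimeFieldToPerfect.primeFieldToPerfect_of_climbRatFuncPerf`, p158667, and
`Theorems.PrimeModelTransfer.primeModelTransfer_of_climbRatFuncPerf`, p461439). KILL-TEST-K8.2.md §4 names the
next, disjoint check of the slot: the kernel «in the first open fibre dimension, d = 4 over 𝔽_p(t)^{perf}
(d ≤ 3 is unconditional by Cossart–Piltant applied to the excellent X_L) — crux-sized». This file types the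
object that check (and every bankable lower rung) is about: the kernel GRADED BY DIMENSION on both sides.

BUILD RULE (cell, director-resolution 2026-08-26T18:53:29Z (B)): this is an OURS vocabulary file, hence
THESES-FREE BY BIRTH — it imports only Mathlib, `Literature.AlgebraicGeometry.Resolution.ResolutionOfSingularities`
(summit vocabulary `Scheme.HasResolution`) and `HarnessLib`; in particular it does NOT import p460619's module
(which imports `Theses.UniversalCells`), so the identification of the `(⊤, ⊤)` grade with the named decl
`CampaignW82.ClimbRatFuncPerf p` is stated here against that decl's BODY (anchor
`climbRatFuncPerfDimLe_top_iff`, right-hand side copied binder for binder) and the one-line `Iff` with the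
NAME belongs in the leaf-side links file (Theorems/UniversalCellsCampaignW82PrimeFieldTransferLinks.lean).

HONEST FRAMING. The `def` below is OURS — a campaign statement that REPLACES THE ROLE of a printed item of
H. Hironaka's manuscript *Resolution of singularities in positive characteristics* (2017-03-23,
[Hironaka2017], lit key `paper:url-3343fd9e678b`; PDF page = printed page, `l.` = line of the page text
file) — namely §17 ¶2, p.89 l.60–62: «When the K has transcendence degree d we can reformulate the
resolution problem to the case of dimension d + dim Z.» (typed AS PRINTED, not asserted, as
`Literature.AlgebraicGeometry.Hironaka2017.S17Methodology.U89_3` / `U89_3_ours`), read with §2 p.4 l.22–24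
(«a perfect base field K of characteristic p > 0»). The printed device trades transcendence degree for
dimension; the slot's replacement climbs ONE transcendental at a time to a PERFECT field and keeps track of
the dimension on both sides — that bookkeeping is exactly the pair of bounds `(m, n)` below. NOT a statement
of the manuscript; nothing here is attributed to its author; no typed candidate of the manuscript is used
even as a hypothesis. AI transcription, weaker than expert review.

CONTENT (non-embedded summit idiom `Scheme.HasResolution`, integral separated schemes of finite type,
ground field passed explicitly as `f : X ⟶ Spec K`, dimension = `topologicalKrullDim` of the carrier with
values in `WithBot ℕ∞`, the idiom of `Cruxes/LocalToGlobal/Lines/birth.lean` `ResolvableDimLe`):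

* `ClimbRatFuncPerfDimLe p m n` — for every PERFECT field `M` of characteristic `p` over which every
  integral separated `M`-scheme of finite type of dimension `≤ m` has a resolution, every integral
  separated scheme of finite type of dimension `≤ n` over every PERFECT field `L` purely inseparable over
  the rational function field `RatFunc M` (so `L ≅ M(t)^{perf}`) has a resolution.
* `climbRatFuncPerfDimLe_mono` — monotone in `m`, antitone in `n` (pure logic).
* `climbRatFuncPerfDimLe_top_iff` — at `(m, n) = (⊤, ⊤)` the bounds are idle and the statement is, binder
  for binder, the body of `CampaignW82.ClimbRatFuncPerf p` (pure logic, `le_top`).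

RUNGS (for the slot's provers res-L1-s82-pv-1 / pv-2; recorded, NOT proved here):
* `n ≤ 3`, every `m`: follows from the named fact `Literature.AlgebraicGeometry.Resolution.CossartPiltant2019`
  (plan/FACT-LIST.md F-02, admissible as a hypothesis; an integral scheme of finite type over the field `L`
  is reduced, separated by assumption, excellent, of dimension `≤ 3`) — the hypothesis on `M` is not used;
  conditional on F-02 only.
* `(m, n) = (⊤, 4)` — and already `(5, 4)` if the proof goes through a family over a curve over `M`, which
  uses the hypothesis in dimension `≤ n + 1` only — is the first open rung (K8.2 §4's «second, disjoint
  check»); it is implied by the summit statement and by `CampaignW82.ClimbRatFuncPerf p`.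
* `(⊤, ⊤)`: the registered kernel itself (open-problem grade per Cruxes/PrimeFieldToPerfect/KERNEL*.md).

BARRIERS (catalogued under `Literature/Barriers/ResolutionOfSingularities/`, namespace
`Literature.Barriers.ResolutionOfSingularities`; they bound every rung with `n ≥ 4` exactly as they bound
the kernel): file `RegularNotGeometricallyRegular.lean` (a regular model over a finite level
`M(t^{1/p^e}) ≅ RatFunc M` need not stay regular over `L`), file `FrobeniusTwistResolution.lean` decl
`not_hasResolution_Spec_frobTwist`, file `InseparableBaseChangeResolution.lean` decls
`not_hasResolution_Spec_dualNumber` / `not_hasResolution_pullback_extField` (no transport of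
`Scheme.HasResolution` along `K → K^{1/p}`). Grading by dimension does not evade them; it isolates the first
dimension (`n = 4`) where they are live, below which F-02 makes the rung a theorem.

VACUITY SELF-CHECK (one line per decl in the docstrings): for prime `p` the `Prop` is never trivially false
(every instance follows from the summit statement `ResolutionInChar p`); it is trivially true exactly for
`n = ⊥` (an integral scheme is nonempty, so `topologicalKrullDim X ≤ ⊥` cannot hold), easy for `n = 0`,
a theorem for `1 ≤ n ≤ 3` (above), open for `n ≥ 4`. For composite `p > 1` there is no field of
characteristic `p` (vacuous); `p = 0` is characteristic zero and not intended.

## References (vocabulary and locators only; nothing cited as a premise)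
* H. Hironaka, ms. 2017-03-23, §17 ¶2 p.89 l.59–62; §2 p.4 l.22–24 — under adjudication, quoted for the
  role replaced, not asserted. [Hironaka2017]
* V. Cossart, O. Piltant, J. Algebra 529 (2019), Thm. 1.1 — the named fact F-02 behind the rungs `n ≤ 3`
  (not used in this file). [CossartPiltant2019]
* L/res-L1-k82/KILL-TEST-K8.2.md §4; plan/RESCUE-SEED.md row W8.2; L/SLOTS.md §2 W8.2 — cell files, OURS.
-/

noncomputable section

set_option linter.dupNamespace false -- mandated namespace of this single-conjunct summit

open _root_.CategoryTheory _root_.AlgebraicGeometry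
open Literature.AlgebraicGeometry.Resolution

namespace Summit.ResolutionOfSingularities.ResolutionOfSingularities.Theorems.CampaignW82

/-! ## The dimension-graded climb kernel -/

/-- [OURS · L1 W8.2] replaces the role of §17 ¶2, p.89 l.60–62 («When the K has transcendence degree d we
can reformulate the resolution problem to the case of dimension d + dim Z»; typed as
`S17Methodology.U89_3` / `U89_3_ours`) ONE TRANSCENDENTAL AT A TIME over a PERFECT constant field and
GRADED BY DIMENSION on both sides, in the non-embedded summit idiom; NOT a statement of the manuscript.
THE DIMENSION-GRADED CLIMB KERNEL at `p` with bounds `(m, n)`: for every PERFECT field `M` of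
characteristic `p` over which every integral separated `M`-scheme of finite type of topological Krull
dimension `≤ m` has a resolution (`Scheme.HasResolution`), every integral separated scheme of finite type
of dimension `≤ n` over every PERFECT field `L` purely inseparable over `RatFunc M` (i.e. `L ≅ M(t)^{perf}`)
has a resolution. At `(m, n) = (⊤, ⊤)` this is, binder for binder up to the idle bounds `≤ ⊤`, the
registered open kernel `CampaignW82.ClimbRatFuncPerf p` (= stub `stub_climbRatFuncPerf` of stmt-15233 and
of stmt-8933) — see `climbRatFuncPerfDimLe_top_iff`; monotone in `m`, antitone in `n`
(`climbRatFuncPerfDimLe_mono`). Rungs (not proved here): `n ≤ 3` for every `m` from the named fact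
`CossartPiltant2019` (FACT-LIST F-02; the hypothesis on `M` is then unused); `(⊤, 4)` (resp. `(5, 4)` via
a family over a curve over `M`) is the first open rung. Vacuity (prime `p`): trivially true only at
`n = ⊥` (integral schemes are nonempty); never trivially false (every instance follows from
`ResolutionInChar p`); composite `p > 1` admits no field of characteristic `p` (vacuous). [folklore] -/
def ClimbRatFuncPerfDimLe (p : ℕ) (m n : WithBot ℕ∞) : Prop :=
  ∀ (M : Type) [Field M] [CharP M p] [PerfectField M],
    (∀ (X : Scheme.{0}) (f : X ⟶ Spec (.of M)),
        IsSeparated f → LocallyOfFiniteType f → QuasiCompact f → IsIntegral X →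
          topologicalKrullDim X ≤ m → Scheme.HasResolution X) →
      ∀ (L : Type) [Field L] [PerfectField L] [Algebra (RatFunc M) L] [IsPurelyInseparable (RatFunc M) L]
        (X : Scheme.{0}) (f : X ⟶ Spec (.of L)),
        IsSeparated f → LocallyOfFiniteType f → QuasiCompact f → IsIntegral X →
          topologicalKrullDim X ≤ n → Scheme.HasResolution X

/-! ## Pure-logic anchors -/

/-- **Monotonicity of the graded kernel** (pure logic): enlarging the hypothesis bound `m` or shrinking the
conclusion bound `n` weakens the statement — `ClimbRatFuncPerfDimLe p m n → ClimbRatFuncPerfDimLe p m' n'`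
whenever `m ≤ m'` and `n' ≤ n`. In particular every rung `(m, n)` follows from the kernel grade `(⊤, ⊤)`
only through `(m, ⊤)`, NOT directly (the hypothesis side goes the other way): `(⊤, n)` is the weakest
grade with conclusion bound `n`. [folklore] -/
theorem climbRatFuncPerfDimLe_mono {p : ℕ} {m m' n n' : WithBot ℕ∞} (hm : m ≤ m') (hn : n' ≤ n)
    (h : ClimbRatFuncPerfDimLe p m n) : ClimbRatFuncPerfDimLe p m' n' :=
  fun M _ _ _ hM L _ _ _ _ X f hs hl hq hX hd =>
    h M (fun Y g hs' hl' hq' hY hdY => hM Y g hs' hl' hq' hY (hdY.trans hm)) L X f hs hl hq hX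
      (hd.trans hn)

/-- **The top grade is the registered kernel** (pure logic, `le_top`): at `(m, n) = (⊤, ⊤)` both dimension
bounds are idle, and `ClimbRatFuncPerfDimLe p ⊤ ⊤` is equivalent to the statement displayed on the right,
which is — binder for binder — the BODY of `CampaignW82.ClimbRatFuncPerf p`
(Theorems/UniversalCellsCampaignW82PrimeFieldTransfer.lean, p460619; not imported here by the cell's build
rule, so the `Iff` with the NAME is left to the leaf-side links file, where it is `Iff.rfl` after this
lemma). [folklore] -/
theorem climbRatFuncPerfDimLe_top_iff (p : ℕ) :
    ClimbRatFuncPerfDimLe p ⊤ ⊤ ↔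
      ∀ (M : Type) [Field M] [CharP M p] [PerfectField M],
        (∀ (X : Scheme.{0}) (f : X ⟶ Spec (.of M)),
            IsSeparated f → LocallyOfFiniteType f → QuasiCompact f → IsIntegral X →
              Scheme.HasResolution X) →
          ∀ (L : Type) [Field L] [PerfectField L] [Algebra (RatFunc M) L]
            [IsPurelyInseparable (RatFunc M) L] (X : Scheme.{0}) (f : X ⟶ Spec (.of L)),
            IsSeparated f → LocallyOfFiniteType f → QuasiCompact f → IsIntegral X →
              Scheme.HasResolution X := by
  constructor
  · intro h M _ _ _ hM L _ _ _ _ X f hs hl hq hX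
    exact h M (fun Y g hs' hl' hq' hY _ => hM Y g hs' hl' hq' hY) L X f hs hl hq hX le_top
  · intro h M _ _ _ hM L _ _ _ _ X f hs hl hq hX _
    exact h M (fun Y g hs' hl' hq' hY => hM Y g hs' hl' hq' hY le_top) L X f hs hl hq hX

end Summit.ResolutionOfSingularities.ResolutionOfSingularities.Theorems.CampaignW82

end
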